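import Summits.KontsevichZagierPeriods.Zeta5Search.Certificates.RayH1KernelNuCellsA
import Summits.KontsevichZagierPeriods.Zeta5Search.Certificates.RayKernelBrick
import HarnessLib

/-!
# ζ(5) search — certificates: the BRICK CELL lemma of the ray RayH1 (TYPER g16)

HONEST FRAMING: systematic search; no irrationality claim unless certified.  `p`-adic bookkeeping; nothing about `ζ(5)`.

OUR work (Summit side; typer seat, generation 16; generator `gen_kernelnu.py H1`).  All 192 certified `ν`-cells of the ray
(`h1Cells`, `h1Cells_check`) and the window lemma a kernel assembly consumes:

* `nu_ge_of_cell_h1` — `C ∈ h1Cells`, `a₀·p < b₀·n`, `b₁·n < a₁·p` (`θ = p/n > 1`, `m = 0`) ⇒ `C.c ≤ ν(b; i, p)` for every `i`;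
* **`cell_brick_h1`** — with moreover `n < p ≤ 34n`, `34n < p²`, `13 < p` and `k ≤ 2·C.c`:
  `p^k ∣ wedgeNumZ b b′` and `p^k ∣ qNumZ b b′` (GENERIC `RayKernel.brick_cert` = fam-denom 62 `padicOrdGe_sharp_ints` by name,
  `ν′ ≥ ν` by `nuPair_bH1'_ge`).
-/

noncomputable section

open Finset

namespace Summit.KontsevichZagierPeriods.Zeta5Search.RayH1

open Summit.KontsevichZagierPeriods.Zeta5Search.DualSeries
open Summit.KontsevichZagierPeriods.Zeta5Search.DualSeriesDenominators
open Summit.KontsevichZagierPeriods.Zeta5Search.RayKernel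
open Summit.KontsevichZagierPeriods.Zeta5Search.Denom.DigitCert
open Summit.KontsevichZagierPeriods.Zeta5Search.Denom.DualSeriesBrickOrd (nuPair)

/-- All certified cells of the ray. -/
def h1Cells : List Cell :=
  h1Cells_0 ++ h1Cells_1 ++ h1Cells_2 ++ h1Cells_3 ++ h1Cells_4 ++ h1Cells_5 ++ h1Cells_6 ++ h1Cells_7

/-- Kernel verification of the whole table. -/
theorem h1Cells_check : h1Cells.all (Cell.check h1Terms) = true := by
  simp only [h1Cells, List.all_append, Bool.and_eq_true]
  exact ⟨⟨⟨⟨⟨⟨⟨h1Cells_0_check, h1Cells_1_check⟩, h1Cells_2_check⟩, h1Cells_3_check⟩, h1Cells_4_check⟩, h1Cells_5_check⟩, h1Cells_6_check⟩, h1Cells_7_check⟩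

/-- **Cell ⇒ brick exponent** (`θ = p/n > 1`): `C ∈ h1Cells`, `a₀·p < b₀·n`, `b₁·n < a₁·p` ⇒ `C.c ≤ ν(b; i, p)` for every `i`. -/
theorem nu_ge_of_cell_h1 {C : Cell} (hC : C ∈ h1Cells) {n p : ℕ} (hp : 0 < p)
    (hx0 : C.a0 * (p : ℤ) < (C.b0 : ℤ) * n) (hx1 : (C.b1 : ℤ) * n < C.a1 * (p : ℤ)) (i : ℕ) :
    C.c ≤ nuPair (bH1 n) i p :=
  nu_ge_of_checked_cell_h1 (List.all_eq_true.1 h1Cells_check C hC) hp 0 (by simpa using hx0) (by simpa using hx1) i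

/-- **BRICK CELL** (`θ > 1`).  For `C ∈ h1Cells`, `1 ≤ n < p ≤ 34n`, `34n < p²`, `13 < p`, a prime `p` with
`a₀·p < b₀·n`, `b₁·n < a₁·p`, and `k ≤ 2·C.c`: `p^k ∣ wedgeNumZ b b′` and `p^k ∣ qNumZ b b′`. -/
theorem cell_brick_h1 {C : Cell} (hC : C ∈ h1Cells) {n p : ℕ} (hn : 1 ≤ n) (hp : p.Prime) (hnp : n < p)
    (hpB : p ≤ 34 * n) (hsq : 34 * n < p ^ 2) (hpc : 13 < p)
    (hx0 : C.a0 * (p : ℤ) < (C.b0 : ℤ) * n) (hx1 : (C.b1 : ℤ) * n < C.a1 * (p : ℤ)) {k : ℕ} (hk : (k : ℤ) ≤ 2 * C.c) :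
    (p : ℤ) ^ k ∣ wedgeNumZ (bH1 n) (bH1' n) ∧ (p : ℤ) ^ k ∣ qNumZ (bH1 n) (bH1' n) := by
  haveI := Fact.mk hp
  have hp0 : 0 < p := hp.pos
  have hν : ∀ i, i ≤ bn (bH1 n) 0 → C.c ≤ nuPair (bH1 n) i p := fun i _ => nu_ge_of_cell_h1 hC hp0 hx0 hx1 i
  have hnd : ¬ p ∣ n := fun h => absurd (Nat.le_of_dvd (by omega) h) (by omega)
  have hnd' : ∀ a : ℕ, 0 < a → a < p → ¬ (p : ℤ) ∣ (a : ℤ) * n := by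
    intro a ha hap hdvd
    have : p ∣ a * n := by exact_mod_cast hdvd
    rcases (Nat.Prime.dvd_mul hp).1 this with h | h
    · exact absurd (Nat.le_of_dvd ha h) (by omega)
    · exact hnd h
  have h13 : ¬ (p : ℤ) ∣ 12 * n := by exact_mod_cast hnd' 12 (by norm_num) (by omega)
  have h14 : ¬ (p : ℤ) ∣ 13 * n := by exact_mod_cast hnd' 13 (by norm_num) (by omega)
  have hν' : ∀ i, i ≤ bn (bH1' n) 0 → C.c ≤ nuPair (bH1' n) i p :=
    fun i _ => (nu_ge_of_cell_h1 hC hp0 hx0 hx1 i).trans (nuPair_bH1'_ge hp0 h13 h14 i)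
  refine brick_cert (sharpAdmissible_bH1 hn) (sharpAdmissible_bH1' hn) (bn0_bH1' n) (by omega)
    (by rw [bn_bH1_zero]; exact hpB) (by rw [bn_bH1_zero]; exact hsq) hν hν' (by linarith)

/-- **BRICK CELL, shifted** (`θ = p/n ∈ (1/(m+1), 1/m)`): for `C ∈ h1Cells`, `1 ≤ n`, a prime `p ∤ n` with `p ≤ 34n`,
`34n < p²`, `13 < p`, `a₀·p < b₀·(n − m p)`, `b₁·(n − m p) < a₁·p`, and `k ≤ 2·C.c`: `p^k ∣ wedgeNumZ b b′` and
`p^k ∣ qNumZ b b′`. -/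
theorem cell_brick_shift_h1 {C : Cell} (hC : C ∈ h1Cells) {n p : ℕ} (hn : 1 ≤ n) (hp : p.Prime) (hnd : ¬ p ∣ n)
    (hpB : p ≤ 34 * n) (hsq : 34 * n < p ^ 2) (hpc : 13 < p) (m : ℕ)
    (hx0 : C.a0 * (p : ℤ) < (C.b0 : ℤ) * ((n : ℤ) - m * p)) (hx1 : (C.b1 : ℤ) * ((n : ℤ) - m * p) < C.a1 * (p : ℤ))
    {k : ℕ} (hk : (k : ℤ) ≤ 2 * C.c) :
    (p : ℤ) ^ k ∣ wedgeNumZ (bH1 n) (bH1' n) ∧ (p : ℤ) ^ k ∣ qNumZ (bH1 n) (bH1' n) := by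
  haveI := Fact.mk hp
  have hp0 : 0 < p := hp.pos
  have hcheck := List.all_eq_true.1 h1Cells_check C hC
  have hν : ∀ i, i ≤ bn (bH1 n) 0 → C.c ≤ nuPair (bH1 n) i p :=
    fun i _ => nu_ge_of_checked_cell_h1 hcheck hp0 m hx0 hx1 i
  have hnd' : ∀ a : ℕ, 0 < a → a < p → ¬ (p : ℤ) ∣ (a : ℤ) * n := by
    intro a ha hap hdvd
    have : p ∣ a * n := by exact_mod_cast hdvd
    rcases (Nat.Prime.dvd_mul hp).1 this with h | h
    · exact absurd (Nat.le_of_dvd ha h) (by omega)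
    · exact hnd h
  have h13 : ¬ (p : ℤ) ∣ 12 * n := by exact_mod_cast hnd' 12 (by norm_num) (by omega)
  have h14 : ¬ (p : ℤ) ∣ 13 * n := by exact_mod_cast hnd' 13 (by norm_num) (by omega)
  have hν' : ∀ i, i ≤ bn (bH1' n) 0 → C.c ≤ nuPair (bH1' n) i p :=
    fun i _ => (nu_ge_of_checked_cell_h1 hcheck hp0 m hx0 hx1 i).trans (nuPair_bH1'_ge hp0 h13 h14 i)
  refine brick_cert (sharpAdmissible_bH1 hn) (sharpAdmissible_bH1' hn) (bn0_bH1' n) (by omega)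
    (by rw [bn_bH1_zero]; exact hpB) (by rw [bn_bH1_zero]; exact hsq) hν hν' (by linarith)

end Summit.KontsevichZagierPeriods.Zeta5Search.RayH1
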